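import Summits.SmoothPoincare4.SmoothPoincare4.Theorems.SymplecticOrigamiGromovRecognitionRelEndGlueDefs
import Summits.SmoothPoincare4.SmoothPoincare4.Theorems.SymplecticOrigamiGromovRecognitionRelEndMoebiusHomotopic
import Summits.SmoothPoincare4.SmoothPoincare4.Theorems.SymplecticOrigamiGromovRecognitionRelEndCaseALeaf
import Mathlib.Analysis.Calculus.Deriv.Inv
import Mathlib.Geometry.Manifold.MFDeriv.FDeriv

/-!
# A leaf stays a leaf when its two charts are swapped
(registered helper `helper_leaf_swap` of line `cross-cap-laurent`, crux `GromovRecognitionRelEnd`,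
item stmt-SmoothPoincare4-11009; joint-step lemma J9 of the glue of the bi-foliation)

Setting: a LEAF `(u, v)` of the family of `F₀` (`IsLeafOf JX F₀ u v`: an embedded `JX`-holomorphic
two-chart sphere `v z = u z⁻¹` with a trivial-normal-bundle witness `(N, π)` whose glued map `F` is
homotopic to `F₀`).  Claim (`helper_leaf_swap`): the chart-swapped pair `(v, u)` is again a leaf of
the family of `F₀`, with the same image `pairImage v u = pairImage u v`.

Proof.  The swapped pair is a two-chart sphere (`CaseALeaf.twoChartSphere_swap`) with the same
image (two applications of `CaseALeaf.pairImage_subset_swap`).  It is embedded: `v` is injective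
(`v z = u z⁻¹` off `0`, `u` injective, `v 0 ∉ range u`); `dv (w)` is injective at `w = 0` by
hypothesis and at `w ≠ 0` by the chain rule for `v = u ∘ (·)⁻¹` near `w` (the differential of the
inversion is multiplication by `-w⁻²`); `du (0)` is injective; and `u 0 ∉ range v`.  The same
`(N, π)` is a normal witness since the image is unchanged.  Finally `helper_swapGlued` provides
`σ ∼ id` with `F ∘ σ` glued to `(v, u)`, and `F ∘ σ ∼ F ∘ id = F ∼ F₀`.

References: D. McDuff, J. Amer. Math. Soc. 3 (1990), §3 (two-chart presentation of embedded
spheres).  No new definitions, notation or instances.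
-/

noncomputable section

open scoped Manifold ContDiff Topology
open Set Function Filter Literature.Topology.FourManifolds Literature.Topology.FourManifolds.ComplexProjectiveSpace
  Literature.Geometry.Symplectic

-- the prescribed namespace `Summit.<P>.<Sub>.…` duplicates `SmoothPoincare4` (P = Sub)
set_option linter.dupNamespace false

namespace Summit.SmoothPoincare4.SmoothPoincare4.Theorems.GromovRecognitionRelEnd.CrossCapLaurent

namespace LeafSwap

variable {X : Type} [TopologicalSpace X] [ChartedSpace (EuclideanSpace ℝ (Fin 4)) X]

/-- **Chain rule for the chart at infinity.**  If `u` is smooth and `v z = u z⁻¹` for `z ≠ 0`, then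
at `w ≠ 0` the differential of `v` is `du (w⁻¹)` composed with the (real) differential
`ζ ↦ ζ • (-(w ^ 2)⁻¹)` of the inversion. -/
theorem mfderiv_eq_comp_inv [IsManifold (𝓡 4) ∞ X] {u v : ℂ → X}
    (hu : ContMDiff 𝓘(ℝ, ℂ) (𝓡 4) ∞ u) (hc : ∀ z : ℂ, z ≠ 0 → v z = u z⁻¹) {w : ℂ} (hw : w ≠ 0) :
    mfderiv 𝓘(ℝ, ℂ) (𝓡 4) v w =
      (mfderiv 𝓘(ℝ, ℂ) (𝓡 4) u w⁻¹).comp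
        ((ContinuousLinearMap.smulRight (1 : ℂ →L[ℂ] ℂ) (-(w ^ 2)⁻¹)).restrictScalars ℝ) := by
  have hinv : HasMFDerivAt 𝓘(ℝ, ℂ) 𝓘(ℝ, ℂ) (fun z : ℂ => z⁻¹) w
      ((ContinuousLinearMap.smulRight (1 : ℂ →L[ℂ] ℂ) (-(w ^ 2)⁻¹)).restrictScalars ℝ) :=
    hasMFDerivAt_iff_hasFDerivAt.mpr ((hasDerivAt_inv hw).hasFDerivAt.restrictScalars ℝ)
  have hu' : HasMFDerivAt 𝓘(ℝ, ℂ) (𝓡 4) u ((fun z : ℂ => z⁻¹) w)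
      (mfderiv 𝓘(ℝ, ℂ) (𝓡 4) u w⁻¹) :=
    (hu.mdifferentiableAt (by simp)).hasMFDerivAt
  have hev : v =ᶠ[𝓝 w] (u ∘ fun z : ℂ => z⁻¹) := by
    filter_upwards [isOpen_ne.mem_nhds hw] with z hz
    exact hc z hz
  exact ((hu'.comp w hinv).congr_of_eventuallyEq hev).mfderiv

omit [TopologicalSpace X] [ChartedSpace (EuclideanSpace ℝ (Fin 4)) X] in
/-- **The chart at infinity of an embedded pair is injective**: `v z = u z⁻¹` off `0`, `u` is
injective, and `v 0 ∉ range u`. -/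
theorem injective_infty {u v : ℂ → X} (hc : ∀ z : ℂ, z ≠ 0 → v z = u z⁻¹) (hinj : Injective u)
    (hinf : v 0 ∉ range u) : Injective v := by
  intro z z' h
  by_cases hz : z = 0
  · by_cases hz' : z' = 0
    · rw [hz, hz']
    · subst hz
      rw [hc z' hz'] at h
      exact absurd ⟨z'⁻¹, h.symm⟩ hinf
  · by_cases hz' : z' = 0
    · subst hz'
      rw [hc z hz] at h
      exact absurd ⟨z⁻¹, h⟩ hinf
    · rw [hc z hz, hc z' hz'] at h
      exact inv_injective (hinj h)

/-- **The chart swap of an embedded two-chart sphere is embedded.** -/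
theorem isEmbeddedPair_swap [IsManifold (𝓡 4) ∞ X] {u v : ℂ → X}
    (hu : ContMDiff 𝓘(ℝ, ℂ) (𝓡 4) ∞ u) (hc : ∀ z : ℂ, z ≠ 0 → v z = u z⁻¹)
    (hE : IsEmbeddedPair u v) : IsEmbeddedPair v u := by
  refine ⟨injective_infty hc hE.injective hE.infty_notMem, fun w => ?_, hE.imm_u 0, ?_⟩
  · -- `dv (w)` is injective
    by_cases hw : w = 0
    · rw [hw]
      exact hE.imm_v
    · rw [mfderiv_eq_comp_inv hu hc hw]
      refine fun (ζ : ℂ) (ζ' : ℂ) h => ?_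
      have hw2 : (-(w ^ 2)⁻¹ : ℂ) ≠ 0 := neg_ne_zero.mpr (inv_ne_zero (pow_ne_zero 2 hw))
      have h' : mfderiv 𝓘(ℝ, ℂ) (𝓡 4) u w⁻¹
            ((ContinuousLinearMap.smulRight (1 : ℂ →L[ℂ] ℂ) (-(w ^ 2)⁻¹)).restrictScalars ℝ ζ) =
          mfderiv 𝓘(ℝ, ℂ) (𝓡 4) u w⁻¹
            ((ContinuousLinearMap.smulRight (1 : ℂ →L[ℂ] ℂ) (-(w ^ 2)⁻¹)).restrictScalars ℝ ζ') := h
      have h2 : ((ContinuousLinearMap.smulRight (1 : ℂ →L[ℂ] ℂ) (-(w ^ 2)⁻¹)).restrictScalars ℝ ζ :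
          ℂ) = (ContinuousLinearMap.smulRight (1 : ℂ →L[ℂ] ℂ) (-(w ^ 2)⁻¹)).restrictScalars ℝ ζ' :=
        hE.imm_u w⁻¹ h'
      simp only [ContinuousLinearMap.coe_restrictScalars', ContinuousLinearMap.smulRight_apply,
        one_apply_eq_self, smul_eq_mul] at h2
      exact mul_right_cancel₀ (M₀ := ℂ) hw2 h2
  · -- `u 0 ∉ range v`
    rintro ⟨w, hw⟩
    by_cases hw0 : w = 0
    · rw [hw0] at hw
      exact hE.infty_notMem ⟨0, hw.symm⟩
    · rw [hc w hw0] at hw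
      exact hw0 (inv_eq_zero.mp (hE.injective hw))

omit [TopologicalSpace X] [ChartedSpace (EuclideanSpace ℝ (Fin 4)) X] in
/-- **The chart swap does not change the image.** -/
theorem pairImage_swap {u v : ℂ → X} (hc : ∀ z : ℂ, z ≠ 0 → v z = u z⁻¹) :
    pairImage v u = pairImage u v :=
  Subset.antisymm
    (CaseALeaf.pairImage_subset_swap fun z hz => by rw [hc z⁻¹ (inv_ne_zero hz), inv_inv])
    (CaseALeaf.pairImage_subset_swap hc)

/-- **A normal witness of a pair is a normal witness of the swapped pair** (same image). -/
theorem isNormalWitness_swap {u v : ℂ → X} {N : Set X} {π : X → ℂ}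
    (hc : ∀ z : ℂ, z ≠ 0 → v z = u z⁻¹) (hN : IsNormalWitness N π u v) :
    IsNormalWitness N π v u := by
  have himg : range v ∪ {u 0} = range u ∪ {v 0} := by
    rw [← pairImage_eq, ← pairImage_eq]
    exact pairImage_swap hc
  refine ⟨hN.isOpen, ?_, hN.smooth, hN.submersive, ?_⟩
  · rw [himg]
    exact hN.image_subset
  · rw [himg]
    exact hN.zeroSet_eq

end LeafSwap

open LeafSwap CaseALeaf

/-- **J9 (registered helper `helper_leaf_swap`): a leaf stays a leaf when the two charts are
swapped, with the same image.**  The swapped pair `(v, u)` is a two-chart sphere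
(`twoChartSphere_swap`), embedded (`LeafSwap.isEmbeddedPair_swap`: injectivity of `v`, chain rule
for `v = u ∘ (·)⁻¹` off `0`), has the same normal witness (the image is unchanged,
`LeafSwap.pairImage_swap`), and its glued map `F ∘ σ` (`helper_swapGlued`, `σ ∼ id`) is homotopic
to `F ∼ F₀`. -/
theorem helper_leaf_swap : ∀ (X : Type) [TopologicalSpace X]
    [ChartedSpace (EuclideanSpace ℝ (Fin 4)) X] [IsManifold (𝓡 4) ∞ X]
    (JX : ∀ y : X, TangentSpace (𝓡 4) y →L[ℝ] TangentSpace (𝓡 4) y)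
    (F₀ : C(ComplexProjectiveSpace 1, X)) (u v : ℂ → X),
    IsLeafOf JX F₀ u v → IsLeafOf JX F₀ v u ∧ pairImage v u = pairImage u v := by
  intro X _ _ _ JX F₀ u v h
  obtain ⟨hS, hE, ⟨N, π, hN⟩, ⟨F, hF, hFF₀⟩⟩ := h
  refine ⟨⟨twoChartSphere_swap hS, isEmbeddedPair_swap hS.smooth_u hS.compat hE,
    ⟨N, π, isNormalWitness_swap hS.compat hN⟩, ?_⟩, pairImage_swap hS.compat⟩
  -- the glued map of the swapped pair: `F ∘ σ ∼ F ∼ F₀`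
  obtain ⟨σ, hσ, h0, h1⟩ := helper_swapGlued X u v F hS.compat hF.chart_zero hF.chart_one
  have hFσ : (F.comp σ).Homotopic F₀ := by
    have h := (ContinuousMap.Homotopic.refl F).comp hσ
    rw [ContinuousMap.comp_id] at h
    exact h.trans hFF₀
  exact ⟨F.comp σ, ⟨h0, h1⟩, hFσ⟩

end Summit.SmoothPoincare4.SmoothPoincare4.Theorems.GromovRecognitionRelEnd.CrossCapLaurent

end
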